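import Mathlib
import HarnessLib
import Summits.NavierStokesRegularity.NavierStokesRegularity.Theses.SymmetryModuliCount
import Literature.Analysis.FluidPDE.TypeIAncientMildClassical
import Literature.Analysis.FluidPDE.PressurePoisson
import Summits.NavierStokesRegularity.NavierStokesRegularity.Theorems.SymmetryModuliCountFarPastLedgerCovering
import Summits.NavierStokesRegularity.NavierStokesRegularity.Theorems.SymmetryModuliCountFarPastLedgerFarShell
import Summits.NavierStokesRegularity.NavierStokesRegularity.Theorems.SymmetryModuliCountFarPastLedgerLinearFluxLedger
import Summits.NavierStokesRegularity.NavierStokesRegularity.Theorems.SymmetryModuliCountFarPastLedgerPressureGradientBound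
import Summits.NavierStokesRegularity.NavierStokesRegularity.Theorems.SymmetryModuliCountFarPastLedgerMeanDisplacement
import Summits.NavierStokesRegularity.NavierStokesRegularity.Theorems.SymmetryModuliCountFarPastLedgerPinning
import Summits.NavierStokesRegularity.NavierStokesRegularity.Theorems.SymmetryModuliCountFarPastLedgerClosure
import Summits.NavierStokesRegularity.NavierStokesRegularity.Theorems.SymmetryModuliCountFarPastLedgerReduction
import Summits.NavierStokesRegularity.NavierStokesRegularity.Theorems.SymmetryModuliCountFarPastLedgerSliceCanonical
import Summits.NavierStokesRegularity.NavierStokesRegularity.Theorems.SymmetryModuliCountFarPastLedgerSliceRate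
import Summits.NavierStokesRegularity.NavierStokesRegularity.Theorems.SymmetryModuliCountFarPastLedgerSliceNear

/-!
# Crux `SymmetryModuliCount.FarPastLedger` (stmt-NavierStokesRegularity-14060) — PROVED
  along the line `uloc-gronwall-transplant`

`∀ C ∃ K ∀ u ∈ A_C ∀ t < 0 ∀ x₀ ∀ R > 0, ∫_{B_R(x₀)} ‖u(t)‖² ≤ K R` for the Type-I ancient mild
class `A_C = IsTypeIAncientMild C` (the far-past energy ledger at the Leray rate). The lead's
registered skeleton (`Cruxes/FarPastLedger/Lines/uloc_gronwall_transplant.lean`) with its seven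
stubs replaced by landed theorems: pressure block `stub_fplPressureGradientBound` (KNSS
smoothing), `stub_fplMeanDisplacement` (the one use of the Oseen identity), `stub_fplSlicePressure`
(Part 1 below), `stub_fplPinning` (the affine mode vanishes) ⇒ `nearFar_window`; ledger block
`stub_fplCovering`, `stub_fplFarShell`, `stub_fplLinearFluxLedger` (local energy identity, fluxes
linear in the unit-ball energies with one Type-I factor); closure `fpl_closure_main` (doubling
Grönwall on the unit window) and `fpl_reduction_main` (scaling/translation to the unit window).

## Part 1 — stub HA `stub_fplSlicePressure` (slice harmonic analysis)

For `w` smooth, bounded by `M`, divergence free, and `q` smooth with `‖Dq‖ ≤ L` and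
`Δq = -div((w·∇)w)`, there is a constant vector `a` such that on EVERY ball `B(x₀, 2)`,
`q = c + ⟪a, ·⟫ + p₁ + p₂` with `‖p₁‖₂² ≤ c₀ M² ∫_{B(x₀,4)}‖w‖²` and
`‖Dp₂‖ ≤ c₀ ∫_{|y-x₀|≥3} ‖w‖² |y-x₀|⁻⁴` on `B(x₀, 2)`, and the bump averages of `∇q` at scale `r`
recover `a` up to `c₀ M²/r`. Assembly: `a = A♯`, `A` the canonical covector of
`fpl_slice_eq_canonical`; on `B(x₀,2)`: partition at `(x₀,1)`, `p₁ = p̃[ηw]`, `p₂ = q - ⟪a,·⟫ - p₁`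
(derivative = minus the far gradient, via consistency through the partition at `(0, |x₀|+3)`);
the rate is `fpl_rate_core` with the partition at `(0, r)`.

## Part 2 — `nearFar_window` (HA + GRADP + PIN + MD on windows) and `FarPastLedger_proof`
-/

noncomputable section

open MeasureTheory Set Filter Metric Topology InnerProductSpace
open scoped ContDiff Laplacian

set_option linter.dupNamespace false -- nested layout Summit.<S>.<Sub>, Sub = S (D-0017)

namespace Summit.NavierStokesRegularity.NavierStokesRegularity.Theorems

open Literature.Analysis.FluidPDE

-- nested operator types `E →L[ℝ] E →L[ℝ] E →L[ℝ] ℝ`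
set_option maxSynthPendingDepth 3

/-- `∫_{B(c, r)} ‖w‖² ≤ M² r³ |B₁|` for `‖w‖ ≤ M`. -/
theorem fpl_setIntegral_norm_sq_le {w : EuclideanSpace ℝ (Fin 3) → EuclideanSpace ℝ (Fin 3)} {M : ℝ}
    (hM : ∀ y, ‖w y‖ ≤ M) (c : EuclideanSpace ℝ (Fin 3)) {r : ℝ} (hr : 0 ≤ r) :
    ∫ y in ball c r, ‖w y‖ ^ 2 ≤
      M ^ 2 * (r ^ 3 * (volume (ball (0 : EuclideanSpace ℝ (Fin 3)) 1)).toReal) := by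
  have hpt : ∀ y, ‖w y‖ ^ 2 ≤ M ^ 2 := fun y => pow_le_pow_left₀ (norm_nonneg _) (hM y) 2
  calc ∫ y in ball c r, ‖w y‖ ^ 2 ≤ ∫ _y in ball c r, M ^ 2 :=
      integral_mono_of_nonneg (Eventually.of_forall fun y => by positivity)
        (integrableOn_const measure_ball_lt_top.ne) (Eventually.of_forall hpt)
    _ = M ^ 2 * (r ^ 3 * (volume (ball (0 : EuclideanSpace ℝ (Fin 3)) 1)).toReal) := by
      rw [setIntegral_const, smul_eq_mul, measureReal_def, fpl_volume_ball_toReal c hr, mul_comm]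

set_option maxHeartbeats 400000 in -- large assembly proof; insurance against farm variance
/-- **Stub HA** (`stub_fplSlicePressure`) of the line `uloc-gronwall-transplant`. -/
theorem stub_fplSlicePressure :
    ∃ c₀ : ℝ, 0 ≤ c₀ ∧
    ∀ (M L : ℝ) (w : EuclideanSpace ℝ (Fin 3) → EuclideanSpace ℝ (Fin 3))
      (q : EuclideanSpace ℝ (Fin 3) → ℝ),
    ContDiff ℝ (⊤ : ℕ∞) w → ContDiff ℝ (⊤ : ℕ∞) q →
    Literature.Analysis.FluidPDE.VectorCalculus.IsDivFree w →
    (∀ x, ‖w x‖ ≤ M) → (∀ x, ‖fderiv ℝ q x‖ ≤ L) →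
    (∀ x, Laplacian.laplacian q x =
      -Literature.Analysis.FluidPDE.VectorCalculus.divergence
        (Literature.Analysis.FluidPDE.convect w w) x) →
    ∃ a : EuclideanSpace ℝ (Fin 3),
      (∀ x₀ : EuclideanSpace ℝ (Fin 3), ∃ (c : ℝ) (p₁ p₂ : EuclideanSpace ℝ (Fin 3) → ℝ),
        (∀ x ∈ Metric.ball x₀ 2, q x = c + inner ℝ a x + p₁ x + p₂ x) ∧
        MeasureTheory.MemLp p₁ 2 MeasureTheory.volume ∧
        ∫ x, p₁ x ^ 2 ≤ c₀ * M ^ 2 * ∫ x in Metric.ball x₀ 4, ‖w x‖ ^ 2 ∧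
        ∀ x ∈ Metric.ball x₀ 2, DifferentiableAt ℝ p₂ x ∧
          ‖fderiv ℝ p₂ x‖ ≤ c₀ * ∫ y in (Metric.ball x₀ 3)ᶜ, ‖w y‖ ^ 2 / ‖y - x₀‖ ^ 4) ∧
      ∀ r : ℝ, 1 ≤ r →
        ‖(∫ x, ((⟨1, 2, zero_lt_one, one_lt_two⟩ : ContDiffBump (0 : EuclideanSpace ℝ (Fin 3))) :
              EuclideanSpace ℝ (Fin 3) → ℝ) (r⁻¹ • x))⁻¹ •
            (∫ x, (((⟨1, 2, zero_lt_one, one_lt_two⟩ :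
                ContDiffBump (0 : EuclideanSpace ℝ (Fin 3))) : EuclideanSpace ℝ (Fin 3) → ℝ)
                  (r⁻¹ • x)) • gradient q x) - a‖ ≤ c₀ * M ^ 2 / r := by
  -- absolute constants
  obtain ⟨C_K, hCK0, hCK⟩ := fpl_exists_kernel_bound
  obtain ⟨C_N, hCN0, hCN⟩ := fpl_exists_near_sq_integral_le
  obtain ⟨c_F, hcF0, hcF⟩ := fpl_exists_farShell_scaled
  set V : ℝ := (volume (ball (0 : EuclideanSpace ℝ (Fin 3)) 1)).toReal with hV
  have hV0 : 0 ≤ V := ENNReal.toReal_nonneg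
  -- the bump and its constants
  set θ : EuclideanSpace ℝ (Fin 3) → ℝ :=
    ((⟨1, 2, zero_lt_one, one_lt_two⟩ : ContDiffBump (0 : EuclideanSpace ℝ (Fin 3))) :
      EuclideanSpace ℝ (Fin 3) → ℝ) with hθ
  have hθd : ContDiff ℝ ∞ θ := ContDiffBump.contDiff _
  have hθ0 : ∀ x, 0 ≤ θ x := fun x => ContDiffBump.nonneg _
  have hθsupp : ∀ x ∉ ball (0 : EuclideanSpace ℝ (Fin 3)) 2, θ x = 0 := fun x hx =>
    ContDiffBump.zero_of_le_dist _ (by rw [mem_ball, not_lt] at hx; exact hx)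
  have hm : 0 < ∫ x, θ x := ContDiffBump.integral_pos _
  set m₁ : ℝ := ∫ x, θ x with hm₁
  set Cθ : ℝ := ∫ z, ‖fderiv ℝ θ z‖ ^ 2 with hCθ
  have hCθ0 : 0 ≤ Cθ := integral_nonneg fun z => by positivity
  -- the constant
  set c_rate : ℝ := 8 * Real.sqrt (Cθ * C_N * V) / m₁ + C_K * c_F with hc_rate
  have hc_rate0 : 0 ≤ c_rate := by positivity
  refine ⟨C_N + C_K + c_rate, by positivity, ?_⟩
  intro M L w q hw hq hdiv hM hL hΔq
  have hM0 : 0 ≤ M := (norm_nonneg _).trans (hM 0)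
  -- the canonical covector `A` from the partition at `(0, 1)`
  obtain ⟨η₁, ζ₁, hη₁, hζ₁, h1₁, hη₁0, hζ₁0⟩ :=
    fpl_exists_partition (0 : EuclideanSpace ℝ (Fin 3)) (R := 1) one_pos
  set A : EuclideanSpace ℝ (Fin 3) →L[ℝ] ℝ :=
    fderiv ℝ q 0 - fderiv ℝ (normalisedPressure fun y => η₁ y • w y) 0 +
      ∫ y, (evalDiag (ζ₁ y • w y)).comp (fderiv ℝ (fderiv ℝ (fderiv ℝ (newtonFar (1 / 2) 1))) (0 - y))
    with hA
  set a : EuclideanSpace ℝ (Fin 3) := (toDual ℝ (EuclideanSpace ℝ (Fin 3))).symm A with ha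
  -- the canonical identity for every adapted partition whose ball contains `0`
  have hcanon : ∀ (c : EuclideanSpace ℝ (Fin 3)) (R : ℝ), 1 ≤ R →
      ∀ (η ζ : EuclideanSpace ℝ (Fin 3) → ℝ), ContDiff ℝ ∞ η → ContDiff ℝ ∞ ζ →
      (∀ y, η y ^ 2 + ζ y ^ 2 = 1) → (∀ y ∉ ball c (4 * R), η y = 0) →
      (∀ y ∈ ball c (3 * R), ζ y = 0) → (0 : EuclideanSpace ℝ (Fin 3)) ∈ ball c (2 * R) →
      ∀ x ∈ ball c (2 * R),
        fderiv ℝ q x - fderiv ℝ (normalisedPressure fun y => η y • w y) x +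
          ∫ y, (evalDiag (ζ y • w y)).comp (fderiv ℝ (fderiv ℝ (fderiv ℝ (newtonFar (R / 2) R))) (x - y)) =
        A :=
    fun c R hR η ζ hη hζ h1 hη0 hζ0 hc0 x hx =>
      fpl_slice_eq_canonical hw hdiv hM hq hL hΔq hη₁ hζ₁ h1₁ hη₁0 hζ₁0 hR hη hζ h1 hη0 hζ0 hc0 hx
  refine ⟨a, fun x₀ => ?_, fun r hr => ?_⟩
  · -- the decomposition on `B(x₀, 2)`
    obtain ⟨η, ζ, hη, hζ, h1, hη0, hζ0⟩ := fpl_exists_partition x₀ (R := 1) one_pos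
    have hζ1 : ∀ y, |ζ y| ≤ 1 := fun y => by
      have := h1 y; nlinarith [sq_nonneg (η y), sq_abs (ζ y)]
    have hη1 : ∀ y, |η y| ≤ 1 := fun y => by
      have := h1 y; nlinarith [sq_nonneg (ζ y), sq_abs (η y)]
    set v₁ : EuclideanSpace ℝ (Fin 3) → EuclideanSpace ℝ (Fin 3) := fun y => η y • w y with hv₁
    have hv₁d : ContDiff ℝ ∞ v₁ := hη.smul hw
    have hv₁c : HasCompactSupport v₁ := by
      refine HasCompactSupport.intro (isCompact_closedBall x₀ (4 * 1)) fun y hy => ?_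
      have hy' : y ∉ ball x₀ (4 * 1) := fun h => hy (ball_subset_closedBall h)
      simp [hv₁, hη0 y hy']
    set p₁ : EuclideanSpace ℝ (Fin 3) → ℝ := normalisedPressure v₁ with hp₁
    have hp₁d : ContDiff ℝ ∞ p₁ := contDiff_normalisedPressure_of_contDiff_infty hv₁d hv₁c
    set G : EuclideanSpace ℝ (Fin 3) → EuclideanSpace ℝ (Fin 3) →L[ℝ] ℝ := fun x =>
      ∫ y, (evalDiag (ζ y • w y)).comp (fderiv ℝ (fderiv ℝ (fderiv ℝ (newtonFar (1 / 2) 1))) (x - y))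
      with hG
    set p₂ : EuclideanSpace ℝ (Fin 3) → ℝ := fun x => q x - inner ℝ a x - p₁ x with hp₂
    -- transport of the canonical identity to the partition at `(x₀, 1)`
    have hident : ∀ x ∈ ball x₀ (2 * 1), fderiv ℝ q x - fderiv ℝ p₁ x + G x = A := by
      intro x hx
      -- the partition at `(0, ρ)`, `ρ = ‖x₀‖ + 3`
      set ρ : ℝ := ‖x₀‖ + 3 with hρ
      have hρ1 : 1 ≤ ρ := by rw [hρ]; linarith [norm_nonneg x₀]
      obtain ⟨ηρ, ζρ, hηρ, hζρ, h1ρ, hηρ0, hζρ0⟩ :=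
        fpl_exists_partition (0 : EuclideanSpace ℝ (Fin 3)) (R := ρ) (by linarith)
      have h0ρ : (0 : EuclideanSpace ℝ (Fin 3)) ∈ ball (0 : EuclideanSpace ℝ (Fin 3)) (2 * ρ) :=
        mem_ball_self (by linarith)
      have hxρ : x ∈ ball (0 : EuclideanSpace ℝ (Fin 3)) (2 * ρ) := by
        rw [mem_ball, dist_zero_right]
        rw [mem_ball, dist_eq_norm] at hx
        have : ‖x‖ ≤ ‖x - x₀‖ + ‖x₀‖ := norm_le_norm_sub_add x x₀
        rw [hρ]; linarith
      have hcanρ := hcanon 0 ρ hρ1 ηρ ζρ hηρ hζρ h1ρ hηρ0 hζρ0 h0ρ x hxρ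
      have hcons := fpl_slice_consistency hw hM le_rfl hρ1 hη hζ hηρ hζρ h1 h1ρ hη0 hζ0 hηρ0 hζρ0 hx hxρ
      have e : ∀ (a' b g : EuclideanSpace ℝ (Fin 3) →L[ℝ] ℝ), a' - b + g = a' - (b - g) := fun _ _ _ => by abel
      rw [← hcanρ, e, e, hp₁, hG]
      simp only [hv₁]
      rw [hcons]
    refine ⟨0, p₁, p₂, fun x _ => ?_, ?_, ?_, fun x hx => ?_⟩
    · simp only [hp₂]; ring
    · exact (hCN v₁ hv₁d hv₁c).1
    · -- the near `L²` bound
      have hsq := (hCN v₁ hv₁d hv₁c).2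
      have h4 := fpl_integral_norm_pow_four_le (χ := η) hw.continuous hη1 (c := x₀) (r := 4 * 1) hη0 hM
      have hpos : 0 ≤ ∫ x in ball x₀ 4, ‖w x‖ ^ 2 := integral_nonneg fun x => by positivity
      calc ∫ x, p₁ x ^ 2 ≤ C_N * ∫ x, ‖v₁ x‖ ^ 4 := hsq
        _ ≤ C_N * (M ^ 2 * ∫ x in ball x₀ (4 * 1), ‖w x‖ ^ 2) := mul_le_mul_of_nonneg_left h4 hCN0
        _ = C_N * M ^ 2 * ∫ x in ball x₀ 4, ‖w x‖ ^ 2 := by rw [mul_one, mul_assoc]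
        _ ≤ (C_N + C_K + c_rate) * M ^ 2 * ∫ x in ball x₀ 4, ‖w x‖ ^ 2 := by
            apply mul_le_mul_of_nonneg_right _ hpos
            apply mul_le_mul_of_nonneg_right _ (sq_nonneg M)
            linarith
    · -- the far gradient bound
      have hx1 : x ∈ ball x₀ (2 * 1) := by rwa [mul_one]
      have hdq : DifferentiableAt ℝ q x := (hq.differentiable (by simp)) x
      have hdp₁ : DifferentiableAt ℝ p₁ x := (hp₁d.differentiable (by simp)) x
      have hinner : HasFDerivAt (fun y : EuclideanSpace ℝ (Fin 3) => inner ℝ a y) A x := by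
        have e1 : ((toDual ℝ (EuclideanSpace ℝ (Fin 3))) a : EuclideanSpace ℝ (Fin 3) →L[ℝ] ℝ) = A := by
          rw [ha, LinearIsometryEquiv.apply_symm_apply]
        have h : HasFDerivAt (fun y : EuclideanSpace ℝ (Fin 3) => inner ℝ a y)
            ((toDual ℝ (EuclideanSpace ℝ (Fin 3))) a : EuclideanSpace ℝ (Fin 3) →L[ℝ] ℝ) x :=
          ((toDual ℝ (EuclideanSpace ℝ (Fin 3))) a).hasFDerivAt
        exact h.congr_fderiv e1
      have hdp₂ : HasFDerivAt p₂ (fderiv ℝ q x - A - fderiv ℝ p₁ x) x := by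
        rw [hp₂]
        exact (hdq.hasFDerivAt.sub hinner).sub hdp₁.hasFDerivAt
      refine ⟨hdp₂.differentiableAt, ?_⟩
      rw [hdp₂.fderiv]
      have hGx : fderiv ℝ q x - A - fderiv ℝ p₁ x = -G x := by
        have := hident x hx1
        rw [← this]; abel
      rw [hGx, norm_neg]
      -- `‖G x‖ ≤ C_K ∫ ‖ζw‖²/|y-x₀|⁴ ≤ C_K ∫_{far} ‖w‖²/|y-x₀|⁴`
      have hu0 : ∀ y ∈ ball x₀ (3 * 1), ζ y • w y = 0 := fun y hy => by simp [hζ0 y hy]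
      have huc : Continuous fun y => ζ y • w y := hζ.continuous.smul hw.continuous
      have huM : ∀ y, ‖ζ y • w y‖ ≤ M := fun y => by
        rw [norm_smul, Real.norm_eq_abs]
        calc |ζ y| * ‖w y‖ ≤ 1 * M := mul_le_mul (hζ1 y) (hM y) (norm_nonneg _) zero_le_one
          _ = M := one_mul M
      have hfar := (fpl_norm_farGradient_le hCK le_rfl huc huM hu0 hx1).2
      have hcmp := fpl_far_weight_le hw.continuous hM hζ.continuous hζ1 x₀ le_rfl hζ0
      rw [mul_one] at hcmp
      have hIpos : 0 ≤ ∫ y in (ball x₀ 3)ᶜ, ‖w y‖ ^ 2 / ‖y - x₀‖ ^ 4 :=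
        integral_nonneg fun y => by positivity
      calc ‖G x‖ ≤ C_K * ∫ y, ‖ζ y • w y‖ ^ 2 / ‖y - x₀‖ ^ 4 := hfar
        _ ≤ C_K * ∫ y in (ball x₀ 3)ᶜ, ‖w y‖ ^ 2 / ‖y - x₀‖ ^ 4 := mul_le_mul_of_nonneg_left hcmp hCK0
        _ ≤ (C_N + C_K + c_rate) * ∫ y in (ball x₀ 3)ᶜ, ‖w y‖ ^ 2 / ‖y - x₀‖ ^ 4 := by
            apply mul_le_mul_of_nonneg_right _ hIpos
            linarith
  · -- the rate at scale `r`
    have hr0 : 0 < r := by linarith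
    obtain ⟨η, ζ, hη, hζ, h1, hη0, hζ0⟩ :=
      fpl_exists_partition (0 : EuclideanSpace ℝ (Fin 3)) (R := r) hr0
    have hζ1 : ∀ y, |ζ y| ≤ 1 := fun y => by
      have := h1 y; nlinarith [sq_nonneg (η y), sq_abs (ζ y)]
    have hη1 : ∀ y, |η y| ≤ 1 := fun y => by
      have := h1 y; nlinarith [sq_nonneg (ζ y), sq_abs (η y)]
    have h0r : (0 : EuclideanSpace ℝ (Fin 3)) ∈ ball (0 : EuclideanSpace ℝ (Fin 3)) (2 * r) :=
      mem_ball_self (by linarith)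
    set vr : EuclideanSpace ℝ (Fin 3) → EuclideanSpace ℝ (Fin 3) := fun y => η y • w y with hvr
    have hvrd : ContDiff ℝ ∞ vr := hη.smul hw
    have hvrc : HasCompactSupport vr := by
      refine HasCompactSupport.intro (isCompact_closedBall (0 : EuclideanSpace ℝ (Fin 3)) (4 * r))
        fun y hy => ?_
      have hy' : y ∉ ball (0 : EuclideanSpace ℝ (Fin 3)) (4 * r) := fun h => hy (ball_subset_closedBall h)
      simp [hvr, hη0 y hy']
    set N : EuclideanSpace ℝ (Fin 3) → ℝ := normalisedPressure vr with hN
    have hNd : ContDiff ℝ ∞ N := contDiff_normalisedPressure_of_contDiff_infty hvrd hvrc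
    obtain ⟨hNm, hNsq⟩ := hCN vr hvrd hvrc
    set Gr : EuclideanSpace ℝ (Fin 3) → EuclideanSpace ℝ (Fin 3) →L[ℝ] ℝ := fun x =>
      ∫ y, (evalDiag (ζ y • w y)).comp (fderiv ℝ (fderiv ℝ (fderiv ℝ (newtonFar (r / 2) r))) (x - y))
      with hGr
    have hident : ∀ x ∈ ball (0 : EuclideanSpace ℝ (Fin 3)) (2 * r), fderiv ℝ q x - fderiv ℝ N x + Gr x = A :=
      fun x hx => hcanon 0 r hr η ζ hη hζ h1 hη0 hζ0 h0r x hx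
    -- the far gradient bound `‖Gr x‖ ≤ C_K c_F M² / r` on `B(0, 2r)`
    have hu0 : ∀ y ∈ ball (0 : EuclideanSpace ℝ (Fin 3)) (3 * r), ζ y • w y = 0 := fun y hy => by
      simp [hζ0 y hy]
    have huc : Continuous fun y => ζ y • w y := hζ.continuous.smul hw.continuous
    have huM : ∀ y, ‖ζ y • w y‖ ≤ M := fun y => by
      rw [norm_smul, Real.norm_eq_abs]
      calc |ζ y| * ‖w y‖ ≤ 1 * M := mul_le_mul (hζ1 y) (hM y) (norm_nonneg _) zero_le_one
        _ = M := one_mul M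
    obtain ⟨-, hshell⟩ := hcF w hw.continuous M hM r hr
    have hGbound : ∀ x ∈ ball (0 : EuclideanSpace ℝ (Fin 3)) (2 * r), ‖Gr x‖ ≤ C_K * c_F * M ^ 2 / r := by
      intro x hx
      have hfar := (fpl_norm_farGradient_le hCK hr huc huM hu0 hx).2
      have hcmp := fpl_far_weight_le hw.continuous hM hζ.continuous hζ1 0 hr hζ0
      simp only [sub_zero] at hfar hcmp
      calc ‖Gr x‖ ≤ C_K * ∫ y, ‖ζ y • w y‖ ^ 2 / ‖y‖ ^ 4 := hfar
        _ ≤ C_K * (c_F * M ^ 2 / r) := mul_le_mul_of_nonneg_left (hcmp.trans hshell) hCK0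
        _ = C_K * c_F * M ^ 2 / r := by ring
    -- the `L²` bound `∫ N² ≤ 64 C_N M⁴ V r³`
    have hS : ∫ x, N x ^ 2 ≤ 64 * C_N * M ^ 4 * V * r ^ 3 := by
      have h4 := fpl_integral_norm_pow_four_le (χ := η) hw.continuous hη1 (c := 0) (r := 4 * r) hη0 hM
      calc ∫ x, N x ^ 2 ≤ C_N * ∫ x, ‖vr x‖ ^ 4 := hNsq
        _ ≤ C_N * (M ^ 2 * ∫ x in ball (0 : EuclideanSpace ℝ (Fin 3)) (4 * r), ‖w x‖ ^ 2) :=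
            mul_le_mul_of_nonneg_left h4 hCN0
        _ ≤ C_N * (M ^ 2 * (M ^ 2 * ((4 * r) ^ 3 * V))) := by
            gcongr
            exact fpl_setIntegral_norm_sq_le hM 0 (by linarith)
        _ = 64 * C_N * M ^ 4 * V * r ^ 3 := by ring
    -- the abstract rate estimate
    have key := fpl_rate_core hθd hθ0 hθsupp hm hq hNd hNm hr hident hGbound hS
    refine key.trans ?_
    -- arithmetic: `(r³ m₁)⁻¹ √(r Cθ) √(64 C_N M⁴ V r³) + C_K c_F M²/r ≤ (C_N + C_K + c_rate) M²/r`
    have e1 : Real.sqrt (r * Cθ) * Real.sqrt (64 * C_N * M ^ 4 * V * r ^ 3) =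
        8 * Real.sqrt (Cθ * C_N * V) * M ^ 2 * r ^ 2 := by
      rw [← Real.sqrt_mul (by positivity),
        show r * Cθ * (64 * C_N * M ^ 4 * V * r ^ 3) = (Cθ * C_N * V) * (8 * M ^ 2 * r ^ 2) ^ 2 by ring,
        Real.sqrt_mul (by positivity), Real.sqrt_sq (by positivity)]
      ring
    rw [e1]
    have e2 : (r ^ 3 * m₁)⁻¹ * (8 * Real.sqrt (Cθ * C_N * V) * M ^ 2 * r ^ 2) + C_K * c_F * M ^ 2 / r =
        c_rate * M ^ 2 / r := by
      rw [hc_rate]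
      field_simp
    rw [e2]
    have hrest : c_rate * M ^ 2 / r ≤ (C_N + C_K + c_rate) * M ^ 2 / r := by
      apply div_le_div_of_nonneg_right _ hr0.le
      apply mul_le_mul_of_nonneg_right _ (sq_nonneg M)
      linarith
    exact hrest

/-- From HA + GRADP + PIN + MD (+ the tree's classical pair on windows and pressure Poisson
equation): every `u ∈ A_C` has, on every window `(t₀, 0)`, a classical pressure with the near/far
structure at unit scale, constant `c₀` of HA. -/
theorem nearFar_window {c₀ : ℝ}
    (hHA : ∀ (M L : ℝ) (w : EuclideanSpace ℝ (Fin 3) → EuclideanSpace ℝ (Fin 3)) (q : EuclideanSpace ℝ (Fin 3) → ℝ),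
      ContDiff ℝ (⊤ : ℕ∞) w → ContDiff ℝ (⊤ : ℕ∞) q → VectorCalculus.IsDivFree w →
      (∀ x, ‖w x‖ ≤ M) → (∀ x, ‖fderiv ℝ q x‖ ≤ L) →
      (∀ x, Laplacian.laplacian q x = -VectorCalculus.divergence (convect w w) x) →
      ∃ a : EuclideanSpace ℝ (Fin 3),
        (∀ x₀ : EuclideanSpace ℝ (Fin 3), ∃ (c : ℝ) (p₁ p₂ : EuclideanSpace ℝ (Fin 3) → ℝ),
          (∀ x ∈ ball x₀ 2, q x = c + inner ℝ a x + p₁ x + p₂ x) ∧ MemLp p₁ 2 volume ∧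
          ∫ x, p₁ x ^ 2 ≤ c₀ * M ^ 2 * ∫ x in ball x₀ 4, ‖w x‖ ^ 2 ∧
          ∀ x ∈ ball x₀ 2, DifferentiableAt ℝ p₂ x ∧
            ‖fderiv ℝ p₂ x‖ ≤ c₀ * ∫ y in (ball x₀ 3)ᶜ, ‖w y‖ ^ 2 / ‖y - x₀‖ ^ 4) ∧
        ∀ r : ℝ, 1 ≤ r →
          ‖(∫ x, ((⟨1, 2, zero_lt_one, one_lt_two⟩ : ContDiffBump (0 : EuclideanSpace ℝ (Fin 3))) :
              EuclideanSpace ℝ (Fin 3) → ℝ) (r⁻¹ • x))⁻¹ •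
            (∫ x, (((⟨1, 2, zero_lt_one, one_lt_two⟩ : ContDiffBump (0 : EuclideanSpace ℝ (Fin 3))) :
              EuclideanSpace ℝ (Fin 3) → ℝ) (r⁻¹ • x)) • gradient q x) - a‖ ≤ c₀ * M ^ 2 / r)
    (hc₀ : 0 ≤ c₀) {C : ℝ} {u : ℝ → EuclideanSpace ℝ (Fin 3) → EuclideanSpace ℝ (Fin 3)}
    (hu : IsTypeIAncientMild C u) {t₀ : ℝ} (ht₀ : t₀ < 0) :
    ∃ p : ℝ → EuclideanSpace ℝ (Fin 3) → ℝ, IsClassicalNSSolutionOn (Ioo t₀ 0) 1 0 u p ∧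
      ∀ τ ∈ Ioo t₀ 0, ∀ x₀ : EuclideanSpace ℝ (Fin 3), ∃ (c : ℝ) (p₁ p₂ : EuclideanSpace ℝ (Fin 3) → ℝ),
        (∀ x ∈ ball x₀ 2, p τ x = c + p₁ x + p₂ x) ∧ MemLp p₁ 2 volume ∧
        ∫ x, p₁ x ^ 2 ≤ c₀ * (C ^ 2 / (-τ)) * ∫ x in ball x₀ 4, ‖u τ x‖ ^ 2 ∧
        ∀ x ∈ ball x₀ 2, DifferentiableAt ℝ p₂ x ∧
          ‖fderiv ℝ p₂ x‖ ≤ c₀ * ∫ y in (ball x₀ 3)ᶜ, ‖u τ y‖ ^ 2 / ‖y - x₀‖ ^ 4 := by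
  obtain ⟨p, hp⟩ := hu.exists_isClassicalNSSolutionOn_Ioo ht₀
  refine ⟨p, hp, ?_⟩
  -- the slice lemma at every window time, with `M = C/√(-τ)`
  have hslice : ∀ τ ∈ Ioo t₀ 0, ∃ a : EuclideanSpace ℝ (Fin 3),
      (∀ x₀ : EuclideanSpace ℝ (Fin 3), ∃ (c : ℝ) (p₁ p₂ : EuclideanSpace ℝ (Fin 3) → ℝ),
        (∀ x ∈ ball x₀ 2, p τ x = c + inner ℝ a x + p₁ x + p₂ x) ∧ MemLp p₁ 2 volume ∧
        ∫ x, p₁ x ^ 2 ≤ c₀ * (C / Real.sqrt (-τ)) ^ 2 * ∫ x in ball x₀ 4, ‖u τ x‖ ^ 2 ∧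
        ∀ x ∈ ball x₀ 2, DifferentiableAt ℝ p₂ x ∧
          ‖fderiv ℝ p₂ x‖ ≤ c₀ * ∫ y in (ball x₀ 3)ᶜ, ‖u τ y‖ ^ 2 / ‖y - x₀‖ ^ 4) ∧
      ∀ r : ℝ, 1 ≤ r →
        ‖(∫ x, ((⟨1, 2, zero_lt_one, one_lt_two⟩ : ContDiffBump (0 : EuclideanSpace ℝ (Fin 3))) :
            EuclideanSpace ℝ (Fin 3) → ℝ) (r⁻¹ • x))⁻¹ •
          (∫ x, (((⟨1, 2, zero_lt_one, one_lt_two⟩ : ContDiffBump (0 : EuclideanSpace ℝ (Fin 3))) :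
            EuclideanSpace ℝ (Fin 3) → ℝ) (r⁻¹ • x)) • gradient (p τ) x) - a‖ ≤
          c₀ * (C / Real.sqrt (-τ)) ^ 2 / r := by
    intro τ hτ
    have hτ0 : τ < 0 := hτ.2
    obtain ⟨L, hL⟩ := stub_fplPressureGradientBound C u hu t₀ p hp τ hτ
    refine hHA (C / Real.sqrt (-τ)) L (u τ) (p τ) (hu.contDiff_slice hτ0) (hp.contDiff_pressure hτ)
      (hu.isDivFree hτ0) (fun x => hu.norm_le hτ0 x) hL fun x => ?_
    have hint : τ ∈ interior (Ioo t₀ 0) := by rw [isOpen_Ioo.interior_eq]; exact hτ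
    have key := laplacian_pressure_eq_of_isClassicalNSSolutionOn hp hint x
    simpa [VectorCalculus.divergence] using key
  choose! a ha using hslice
  -- pinning: the affine mode vanishes
  have hpin : ∀ τ ∈ Ioo t₀ 0, a τ = 0 := by
    refine stub_fplPinning C u hu t₀ p hp a (fun τ => c₀ * (C / Real.sqrt (-τ)) ^ 2)
      (fun τ hτ r hr => (ha τ hτ).2 r hr) (fun τ₁ τ₂ _ h₂ => ?_) (stub_fplMeanDisplacement C u hu)
    refine ⟨c₀ * (C ^ 2 / (-τ₂)), fun τ hτ => ?_⟩
    have hτ0 : τ < 0 := lt_of_le_of_lt hτ.2 h₂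
    have e : (C / Real.sqrt (-τ)) ^ 2 = C ^ 2 / (-τ) := by
      rw [div_pow, Real.sq_sqrt (by linarith)]
    rw [e]
    refine mul_le_mul_of_nonneg_left ?_ hc₀
    exact div_le_div_of_nonneg_left (sq_nonneg C) (by linarith) (by linarith [hτ.2])
  -- assemble
  intro τ hτ x₀
  obtain ⟨c, p₁, p₂, hdec, hmem, hnear, hfar⟩ := (ha τ hτ).1 x₀
  refine ⟨c, p₁, p₂, fun x hx => ?_, hmem, ?_, hfar⟩
  · rw [hdec x hx, hpin τ hτ, inner_zero_left, add_zero]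
  · have e : (C / Real.sqrt (-τ)) ^ 2 = C ^ 2 / (-τ) := by
      rw [div_pow, Real.sq_sqrt (by linarith [hτ.2])]
    rw [← e]
    exact hnear

/-- **The crux `SymmetryModuliCount.FarPastLedger`** (stmt-NavierStokesRegularity-14060): the
far-past energy ledger at the Leray rate for Type-I ancient mild Navier–Stokes fields. -/
theorem FarPastLedger_proof :
    Summit.NavierStokesRegularity.NavierStokesRegularity.Theses.SymmetryModuliCount.FarPastLedger := by
  obtain ⟨c₀, hc₀, hHA⟩ := stub_fplSlicePressure
  obtain ⟨cS, -, hS⟩ := stub_fplFarShell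
  obtain ⟨N, hN, hL⟩ := stub_fplLinearFluxLedger c₀ cS
  refine fpl_reduction_main (fpl_closure_main
    (fun c₀' C u p t₀ => ∀ τ ∈ Ioo t₀ 0, ∀ x₀ : EuclideanSpace ℝ (Fin 3),
      ∃ (c : ℝ) (p₁ p₂ : EuclideanSpace ℝ (Fin 3) → ℝ),
      (∀ x ∈ ball x₀ 2, p τ x = c + p₁ x + p₂ x) ∧ MemLp p₁ 2 volume ∧
      ∫ x, p₁ x ^ 2 ≤ c₀' * (C ^ 2 / (-τ)) * ∫ x in ball x₀ 4, ‖u τ x‖ ^ 2 ∧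
      ∀ x ∈ ball x₀ 2, DifferentiableAt ℝ p₂ x ∧
        ‖fderiv ℝ p₂ x‖ ≤ c₀' * ∫ y in (ball x₀ 3)ᶜ, ‖u τ y‖ ^ 2 / ‖y - x₀‖ ^ 4)
    c₀ N hN ?_ ?_)
  · intro C u hu t₀ ht₀
    exact nearFar_window hHA hc₀ hu ht₀
  · intro C u hu t₀ p hp hNF s' t' hs hst ht F₀ B hB hF hBB x₀
    exact hL C u hu t₀ p hp hNF stub_fplCovering (hS stub_fplCovering) s' t' hs hst ht F₀ B hB hF hBB x₀

end Summit.NavierStokesRegularity.NavierStokesRegularity.Theorems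

end
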